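import Literature.AlgebraicGeometry.Motives.CartierDivisorSameDivisorOfOrdAt
import Literature.AlgebraicGeometry.Motives.CartierDivisorEffective
import HarnessLib

/-!
# Effectivity and global sections of a Cartier divisor on a regular scheme, read off the orders at codimension-one points
# (`D ≥ 0 ⇔ cyc(D) ≥ 0`; `Γ(X, 𝒪_X(D)) = {s ∈ K(X) : ord_C(s) + ord_C(D) ≥ 0 for all prime divisors C}`)

Layer `Literature/AlgebraicGeometry/Motives`, namespaces `Literature.AlgebraicGeometry.Motives.RatFn` (§1) and
`Literature.AlgebraicGeometry.Motives.CartierDivisor` (§2–§3).  KERNEL ONLY (theorems; no definition, no named fact, no instance, no `sorry`).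
Companion of ★ `Motives/CartierDivisorSameDivisorOfOrdAt` (`Div(X) → Z¹(X)` injective on a regular scheme: EQUALITY of orders ⇒
`SameDivisor`); this file is the INEQUALITY half: on an integral locally Noetherian scheme `X` all of whose local rings are regular
(`Scheme.IsRegular X`),

* §1 `RatFn.isRegularAt_of_ord_nonneg` — at a codimension-one point (`𝒪_{X,z}` a discrete valuation ring) a nonzero rational function of
  order `≥ 0` is regular; `RatFn.isRegularAt_of_forall_ord_nonneg` — by algebraic Hartogs (★ `RatFn.isRegularAt_of_forall_coheight_le_one`)
  a nonzero rational function with `ord_z ≥ 0` at every codimension-one point of an open `W` is regular on `W`;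
* §2 `CartierDivisor.isEffective_iff_forall_ordAt_nonneg` — **`D ≥ 0` iff `ord_C(D) ≥ 0` for every prime divisor `C`** (Görtz–Wedhorn I,
  Thm. 11.40 (1)/(2) with (11.13.3): on a locally factorial scheme `Div(X) ≅ Z¹(X)` respects effectivity; Hartshorne II Prop. 6.11,
  Prop. 6.3A);
* §3 `CartierDivisor.isSection_iff_forall_ord` — **`s ∈ Γ(X, 𝒪_X(D))` iff `ord_C(s) + ord_C(D) ≥ 0` for every prime divisor `C`**
  (`s ≠ 0`; Görtz–Wedhorn I, (11.9)/(11.13): `Γ(X, 𝒪_X(D)) = {f ∈ K(X) : div(f) + D ≥ 0}`; Hartshorne II Prop. 7.7 (a) for the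
  complete linear system), and the `sections`-membership form.

## References

* [GortzWedhorn2020] U. Görtz, T. Wedhorn, *Algebraic Geometry I*, 2nd ed. (2020), Thm. 6.45 (p. 167) (algebraic Hartogs),
  Section (11.9) (p. 301) and (11.13.3), Lemma 11.37 (p. 309) (`Γ(X, 𝒪_X(D))`, orders), Thm. 11.40 (1)/(2) (Cartier vs Weil divisors on
  normal / locally factorial schemes).
* [Hartshorne1977] R. Hartshorne, *Algebraic Geometry*, GTM 52 (1977), II.6 Prop. 6.3A, Prop. 6.11 and Remark 6.11.2 (pp. 141–142);
  II.7 Prop. 7.7 (a).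
* [Matsumura1987] H. Matsumura, *Commutative Ring Theory*, CSAM 8 (1986), Thm. 11.2 (p. 79).
-/

set_option autoImplicit false

universe u

open CategoryTheory AlgebraicGeometry TopologicalSpace IsLocalRing Order
open Literature.AlgebraicGeometry.Resolution

noncomputable section

namespace Literature.AlgebraicGeometry.Motives

namespace RatFn

variable {X : Scheme.{u}} [IsIntegral X] [IsLocallyNoetherian X]

/-! ## §1 Regularity from non-negative orders -/

/-- **At a codimension-one point with regular local ring, a nonzero rational function of order `≥ 0` is regular**: `𝒪_{X,z}` is
a discrete valuation ring, so either `h ∈ 𝒪_{X,z}`, or `h⁻¹ ∈ 𝔪_z` and then `ord_z h⁻¹ > 0` (★ `IsRegularAt.ord_pos`), i.e.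
`ord_z h < 0`. [cite: Matsumura1987, Thm. 11.2 (p. 79)] [cite: GortzWedhorn2020, (11.13.3) and Lemma 11.37 (p. 309)] -/
theorem isRegularAt_of_ord_nonneg {z : X} (hz : coheight z = 1) (hreg : IsRegularLocalRing (X.presheaf.stalk z))
    {h : X.functionField} (h0 : h ≠ 0) (hord : 0 ≤ Scheme.ord h z) : IsRegularAt z h := by
  haveI := hreg
  haveI := Literature.AlgebraicGeometry.Resolution.isDomain_of_isRegularLocalRing (X.presheaf.stalk z)
  haveI := valuationRing_of_isRegularLocalRing_of_ringKrullDim_le_one (X.presheaf.stalk z)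
    (by rw [AlgebraicGeometry.ringKrullDim_stalk_eq_coheight z]; exact_mod_cast hz.le)
  rcases ValuationRing.isInteger_or_isInteger (X.presheaf.stalk z) h with hint | hint
  · exact (isRegularAt_iff_isInteger z h).mpr hint
  · have hreg' : IsRegularAt z h⁻¹ := (isRegularAt_iff_isInteger z h⁻¹).mpr hint
    by_contra hnot
    have hu : ¬ IsUnitAt z h⁻¹ := fun hu => hnot (by simpa using hu.inv.isRegularAt)
    have hpos := hreg'.ord_pos hu (inv_ne_zero h0) hz
    have hmul := Scheme.ord_mul (x := z) h0 (inv_ne_zero h0)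
    rw [mul_inv_cancel₀ h0, (isUnitAt_one (x := z)).ord_eq_zero] at hmul
    omega

/-- **Hartogs for regularity from orders**: `X` regular; a nonzero rational function with `ord_z h ≥ 0` at every codimension-ONE point
`z` of an open `W` is regular at every point of `W` (at the generic point every rational function is regular; then ★
`isRegularAt_of_forall_coheight_le_one`). [cite: GortzWedhorn2020, Thm. 6.45 (p. 167)] [cite: Hartshorne1977, II.6 Prop. 6.3A] -/
theorem isRegularAt_of_forall_ord_nonneg (hX : Scheme.IsRegular X) {W : X.Opens} {h : X.functionField} (h0 : h ≠ 0)
    (hh : ∀ z : X, z ∈ W → coheight z = 1 → 0 ≤ Scheme.ord h z) {y : X} (hy : y ∈ W) : IsRegularAt y h := by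
  refine isRegularAt_of_forall_coheight_le_one hX (W := W) (fun z hz hz1 => ?_) hy
  rcases hz1.lt_or_eq with hlt | heq
  · have h0' : coheight z = 0 := Order.lt_one_iff.mp hlt
    have hzgen : z = genericPoint X := by
      rw [Order.coheight_eq_zero] at h0'
      have h1 : z ≤ genericPoint X := genericPoint_specializes z
      have h2 : genericPoint X ≤ z := h0' h1
      exact (Specializes.antisymm (Scheme.le_iff_specializes.mp h2) (Scheme.le_iff_specializes.mp h1)).eq
    subst hzgen
    exact (isUnitAt_genericPoint h0).isRegularAt
  · exact isRegularAt_of_ord_nonneg heq (hX z) h0 (hh z hz heq)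

end RatFn

namespace CartierDivisor

open RatFn

variable {X : Scheme.{u}} [IsIntegral X] [IsLocallyNoetherian X]

/-! ## §2 `D ≥ 0` iff all orders at codimension-one points are `≥ 0` -/

/-- **On a regular scheme a Cartier divisor is effective iff its order at every codimension-one point is `≥ 0`** (⇒ ★
`IsEffective.ordAt_nonneg` on any locally Noetherian integral scheme; ⇐ by Hartogs: the local equation `f_i` has `ord_z f_i = ord_z D ≥ 0`
at the codimension-one points of `U_i`, hence is regular on `U_i`). [cite: GortzWedhorn2020, Thm. 11.40 (1)] [cite: Hartshorne1977, II.6 Prop. 6.11 and Remark 6.11.2 (pp. 141–142)] -/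
theorem isEffective_iff_forall_ordAt_nonneg (hX : Scheme.IsRegular X) {D : CartierDivisor X} :
    D.IsEffective ↔ ∀ z : X, coheight z = 1 → 0 ≤ D.ordAt z := by
  refine ⟨fun hD z _ => hD.ordAt_nonneg z, fun h i x hi => ?_⟩
  refine isRegularAt_of_forall_ord_nonneg hX (W := D.U i) (D.f_ne_zero i) (fun z hz hz1 => ?_) hi
  rw [← D.ordAt_eq_ord hz]
  exact h z hz1

/-- `cyc(D) ≥ 0 ⇒ D ≥ 0` on a regular scheme (the `←` direction as a named implication). [cite: GortzWedhorn2020, Thm. 11.40 (1)] -/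
theorem isEffective_of_forall_ordAt_nonneg (hX : Scheme.IsRegular X) {D : CartierDivisor X}
    (h : ∀ z : X, coheight z = 1 → 0 ≤ D.ordAt z) : D.IsEffective :=
  (isEffective_iff_forall_ordAt_nonneg hX).mpr h

/-- The cycle form: `D ≥ 0` iff its Weil cycle ★ `CartierDivisor.cycle` is `≥ 0` pointwise (on a regular scheme; the cycle vanishes
off the codimension-one points). [cite: GortzWedhorn2020, Thm. 11.40 (1)] -/
theorem isEffective_iff_cycle_nonneg (hX : Scheme.IsRegular X) {D : CartierDivisor X} :
    D.IsEffective ↔ ∀ z : X, 0 ≤ D.cycle z := by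
  rw [isEffective_iff_forall_ordAt_nonneg hX]
  refine ⟨fun h z => ?_, fun h z hz => by rw [← cycle_apply]; exact h z⟩
  rw [cycle_apply]
  by_cases hz : coheight z = 1
  · exact h z hz
  · obtain ⟨i, hi⟩ := D.covers z
    rw [D.ordAt_eq_ord hi, Scheme.ord_eq_zero_of_coheight_neq_one hz]

/-! ## §3 `Γ(X, 𝒪_X(D))` read off the orders: `s ∈ Γ(𝒪(D)) ⇔ ord_C(s) + ord_C(D) ≥ 0` -/

/-- **Global sections of `𝒪_X(D)` on a regular scheme**: for `s ≠ 0`, `s ∈ Γ(X, 𝒪_X(D))` (`f_i · s` regular on every `U_i`) iff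
`ord_z(D) + ord_z(s) ≥ 0` at every codimension-one point `z` — i.e. `div(s) + D ≥ 0` as Weil divisors (Görtz–Wedhorn I, (11.9) with
(11.13); Hartshorne II Prop. 7.7 (a)). (⇒ on any locally Noetherian integral scheme; ⇐ by Hartogs.) [cite: GortzWedhorn2020, Section (11.9) (p. 301)] [cite: GortzWedhorn2020, Thm. 11.40 (1)] -/
theorem isSection_iff_forall_ord (hX : Scheme.IsRegular X) {D : CartierDivisor X} {s : X.functionField} (hs : s ≠ 0) :
    D.IsSection s ↔ ∀ z : X, coheight z = 1 → 0 ≤ D.ordAt z + Scheme.ord s z := by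
  constructor
  · intro h z hz
    obtain ⟨i, hi⟩ := D.covers z
    have hreg := (h i z hi).ord_nonneg
    rw [Scheme.ord_mul (D.f_ne_zero i) hs, ← D.ordAt_eq_ord hi] at hreg
    exact hreg
  · intro h i x hi
    refine isRegularAt_of_forall_ord_nonneg hX (W := D.U i) (mul_ne_zero (D.f_ne_zero i) hs) (fun z hz hz1 => ?_) hi
    rw [Scheme.ord_mul (D.f_ne_zero i) hs, ← D.ordAt_eq_ord hz]
    exact h z hz1

/-- The same for membership in the `K`-module of sections `Γ(X, 𝒪_X(D)) ⊆ K(X)` (★ `CartierDivisor.sections`), for `X` over a field `K`.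
[cite: GortzWedhorn2020, Section (11.9) (p. 301)] -/
theorem mem_sections_iff_forall_ord (hX : Scheme.IsRegular X) (K : Type u) [Field K] [X.Over (Spec (.of K))]
    {D : CartierDivisor X} {s : X.functionField} (hs : s ≠ 0) :
    s ∈ D.sections K ↔ ∀ z : X, coheight z = 1 → 0 ≤ D.ordAt z + Scheme.ord s z := by
  rw [mem_sections_iff, isSection_iff_forall_ord hX hs]

/-- **`Γ(X, 𝒪_X(D)) ⊆ Γ(X, 𝒪_X(E))` when `cyc(D) ≤ cyc(E)`** (on a regular scheme): a section of `𝒪(D)` is a section of `𝒪(E)` as soon as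
`ord_z(D) ≤ ord_z(E)` at every codimension-one point. [cite: GortzWedhorn2020, Section (11.9) (p. 301)] [cite: GortzWedhorn2020, Thm. 11.40 (1)] -/
theorem IsSection.mono_of_forall_ordAt_le (hX : Scheme.IsRegular X) {D E : CartierDivisor X}
    (hDE : ∀ z : X, coheight z = 1 → D.ordAt z ≤ E.ordAt z) {s : X.functionField} (hs : D.IsSection s) : E.IsSection s := by
  by_cases h0 : s = 0
  · subst h0
    intro i x _
    rw [mul_zero]
    exact isRegularAt_zero
  · rw [isSection_iff_forall_ord hX h0] at hs ⊢
    intro z hz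
    have := hs z hz
    have := hDE z hz
    omega

end CartierDivisor

end Literature.AlgebraicGeometry.Motives

end
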